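import Summits.ResolutionOfSingularities.ResolutionOfSingularities.Theorems.FrobeniusLadderFInjectiveMacaulayficationQ6PrimeTower
import Mathlib.RingTheory.Polynomial.GaussLemma
import Mathlib.RingTheory.Polynomial.RationalRoot
import Mathlib.RingTheory.Polynomial.UniqueFactorization
import Mathlib.RingTheory.MvPolynomial.Basic
import Mathlib.Algebra.MvPolynomial.Equiv
import Mathlib.RingTheory.Localization.FractionRing
import Mathlib.Algebra.CharP.Algebra
import Mathlib.RingTheory.Ideal.Span
import HarnessLib

/-!
# Q6: `f₂ = x³y³ + x³z³ + y³z³ + z⁶ + x⁸ + y⁸` GENERATES A PRIME IDEAL over every field of characteristic `5`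
# (crux `FInjectiveMacaulayfication`, CN engine calibration Q6 = `stub_q6CNFiModel_char5`; CRUX-PLAN v7 R7.3′, seat res-L1-w45a-stub-3)

Support file for crux stmt-ResolutionOfSingularities-15315. [OURS · L1 W4.5a] — NOT a statement of the manuscript; AI-written,
weaker than expert review.

`f₂ = z⁶ + s·z³ + t` with `s = x³ + y³`, `t = x³y³ + x⁸ + y⁸`. By `Q6PrimeTower.irreducible_sextic` it is irreducible over
`k(x,y)` once `Δ = s² − 4t` is not a square and `t` not a cube there; both reduce (integrally closed `k[x,y]`, then the
specialisation `y ↦ 0`) to `X⁶(1 − 4X²)` not a square and `X⁸` not a cube in `k[X]`. Gauss (monic) brings irreducibility back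
to `k[x,y][z] ≅ k[x,y,z]`, and the UFD turns it into primality.

* `not_sq_specialised`, `not_cube_specialised` (in `k[X]`), `not_sq`, `not_cube` (in `k(x,y)`);
* `irreducible_sextic_R` (in `k[x,y][z]`), `q6_irreducible`, **`q6_isPrime`**, `q6_ne_zero`, `q6_X_ne_zero` (`x̄ⱼ ≠ 0`).
-/

-- single-problem summit: the doubled namespace component is forced
set_option linter.dupNamespace false

noncomputable section

open Polynomial

namespace Summit.ResolutionOfSingularities.ResolutionOfSingularities.Theorems.FInjectiveMacaulayfication.Q6Prime

open Summit.ResolutionOfSingularities.ResolutionOfSingularities.Theorems.FInjectiveMacaulayfication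

variable {k : Type} [Field k]

/-! ## The two specialised facts in `k[X]` -/

/-- Strip one `X`: `X² · A = q²` forces `q = X q'` with `A = q'²`. [folklore] -/
theorem strip_X {A q : k[X]} (h : X ^ 2 * A = q ^ 2) : ∃ q' : k[X], A = q' ^ 2 := by
  have hX : Prime (X : k[X]) := prime_X
  have hdvd : (X : k[X]) ∣ q := hX.dvd_of_dvd_pow (n := 2) ⟨X * A, by rw [← h]; ring⟩
  obtain ⟨q', rfl⟩ := hdvd
  refine ⟨q', ?_⟩
  have h2 : X ^ 2 * A = X ^ 2 * q' ^ 2 := by rw [h]; ring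
  exact mul_left_cancel₀ (pow_ne_zero 2 X_ne_zero) h2

/-- `X⁶(1 − 4X²)` is not a square in `k[X]` (`char k = 5`). [folklore] -/
theorem not_sq_specialised [CharP k 5] (q : k[X]) : q ^ 2 ≠ X ^ 6 - 4 * X ^ 8 := by
  intro hq
  have h1 : X ^ 2 * (X ^ 2 * (X ^ 2 * (1 - 4 * X ^ 2))) = q ^ 2 := by rw [hq]; ring
  obtain ⟨q₁, h₁⟩ := strip_X h1
  obtain ⟨q₂, h₂⟩ := strip_X h₁
  obtain ⟨q₃, h₃⟩ := strip_X h₂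
  -- `q₃² = 1 − 4X²`: degree 1, then coefficients
  have hdeg2 : (1 - 4 * X ^ 2 : k[X]).natDegree = 2 := by
    have h4 : (4 : k) ≠ 0 := by
      intro h0
      have := (CharP.cast_eq_zero_iff k 5 4).mp (by exact_mod_cast h0)
      omega
    have e : (1 - 4 * X ^ 2 : k[X]) = C (-4 : k) * X ^ 2 + 1 := by
      simp only [map_neg, map_ofNat]; ring
    rw [e, natDegree_add_eq_left_of_natDegree_lt] <;> rw [natDegree_C_mul_X_pow 2 _ (neg_ne_zero.mpr h4)]
    simp
  have hq3 : q₃.natDegree = 1 := by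
    have h5 : (q₃ ^ 2).natDegree = 2 := by rw [← h₃, hdeg2]
    rw [natDegree_pow] at h5
    omega
  have hq3' : q₃ = C (q₃.coeff 1) * X + C (q₃.coeff 0) := eq_X_add_C_of_natDegree_le_one hq3.le
  set a := q₃.coeff 1
  set b := q₃.coeff 0
  have h2k : (2 : k) ≠ 0 := by
    intro h0
    have := (CharP.cast_eq_zero_iff k 5 2).mp (by exact_mod_cast h0)
    omega
  have h4 : (4 : k) ≠ 0 := by
    intro h0
    have := (CharP.cast_eq_zero_iff k 5 4).mp (by exact_mod_cast h0)
    omega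
  -- both sides in the normal form `C c₂ X² + C c₁ X + C c₀`
  have hid : C (-4 : k) * X ^ 2 + C (0 : k) * X + C (1 : k) = C (a * a) * X ^ 2 + C (2 * a * b) * X + C (b * b) := by
    have lhs : C (-4 : k) * X ^ 2 + C (0 : k) * X + C (1 : k) = 1 - 4 * X ^ 2 := by
      simp only [map_neg, map_ofNat, map_zero, map_one, zero_mul, add_zero]; ring
    have rhs : C (a * a) * X ^ 2 + C (2 * a * b) * X + C (b * b) = (C a * X + C b) ^ 2 := by
      simp only [map_mul, map_ofNat]; ring
    rw [lhs, rhs, ← hq3']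
    exact h₃
  have e0 := congrArg (Polynomial.coeff · 0) hid
  have e1 := congrArg (Polynomial.coeff · 1) hid
  have e2 := congrArg (Polynomial.coeff · 2) hid
  simp only [coeff_add, coeff_C_mul_X_pow, coeff_C_mul_X, coeff_C] at e0 e1 e2
  norm_num at e0 e1 e2
  -- e0 : 1 = b*b ; e1 : (2 = 0 ∨ a = 0) ∨ b = 0 ; e2 : -4 = a*a
  have hab : a = 0 ∨ b = 0 := by
    rcases e1 with (h | h) | h
    · exact absurd h h2k
    · exact Or.inl h
    · exact Or.inr h
  rcases hab with ha | hb
  · rw [ha, mul_zero] at e2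
    exact h4 (by linear_combination -e2)
  · rw [hb, mul_zero] at e0
    exact one_ne_zero e0

/-- `X⁸` is not a cube in `k[X]`. [folklore] -/
theorem not_cube_specialised (q : k[X]) : q ^ 3 ≠ X ^ 8 := by
  intro hq
  have h := congrArg natDegree hq
  rw [natDegree_pow, natDegree_X_pow] at h
  omega

/-! ## The sextic over a ring -/

/-- The sextic `X⁶ + sX³ + t` is monic over any nontrivial commutative ring. [folklore] -/
theorem sextic_monic' {R : Type} [CommRing R] [Nontrivial R] (s t : R) : (X ^ 6 + C s * X ^ 3 + C t : R[X]).Monic := by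
  have h : (X ^ 6 + C s * X ^ 3 + C t : R[X]) = X ^ 6 + (C s * X ^ 3 + C t) := by ring
  rw [h]
  refine (monic_X_pow 6).add_of_left ?_
  refine (degree_add_le _ _).trans_lt ?_
  rw [max_lt_iff, degree_X_pow]
  refine ⟨(degree_C_mul_X_pow_le 3 s).trans_lt (by exact_mod_cast (by norm_num : (3 : ℕ) < 6)), (degree_C_le).trans_lt ?_⟩
  exact_mod_cast (by norm_num : (0 : ℕ) < 6)

/-- The sextic has degree `6` over any nontrivial commutative ring. [folklore] -/
theorem sextic_natDegree' {R : Type} [CommRing R] [Nontrivial R] (s t : R) :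
    (X ^ 6 + C s * X ^ 3 + C t : R[X]).natDegree = 6 := by
  have h : (X ^ 6 + C s * X ^ 3 + C t : R[X]) = X ^ 6 + (C s * X ^ 3 + C t) := by ring
  rw [h, natDegree_add_eq_left_of_degree_lt, natDegree_X_pow]
  rw [degree_X_pow]
  refine (degree_add_le _ _).trans_lt ?_
  rw [max_lt_iff]
  refine ⟨(degree_C_mul_X_pow_le 3 s).trans_lt (by exact_mod_cast (by norm_num : (3 : ℕ) < 6)), (degree_C_le).trans_lt ?_⟩
  exact_mod_cast (by norm_num : (0 : ℕ) < 6)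

/-! ## In `k[x,y]` and `k(x,y)` -/

/-- The specialisation `x ↦ X, y ↦ 0` of `k[x,y]` into `k[X]`. -/
theorem specialise_X0 :
    MvPolynomial.aeval (R := k) (![Polynomial.X, 0] : Fin 2 → k[X]) (MvPolynomial.X 0) = Polynomial.X := by
  rw [MvPolynomial.aeval_X]; rfl

/-- The specialisation kills `y`. -/
theorem specialise_X1 :
    MvPolynomial.aeval (R := k) (![Polynomial.X, 0] : Fin 2 → k[X]) (MvPolynomial.X 1) = 0 := by
  rw [MvPolynomial.aeval_X]; rfl

/-- **`Δ = (x³+y³)² − 4(x³y³+x⁸+y⁸)` is not a square in `k(x,y)`** (`char k = 5`). [folklore] -/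
theorem not_sq [CharP k 5] (d : FractionRing (MvPolynomial (Fin 2) k)) :
    d ^ 2 ≠ algebraMap (MvPolynomial (Fin 2) k) (FractionRing (MvPolynomial (Fin 2) k))
      ((MvPolynomial.X 0 ^ 3 + MvPolynomial.X 1 ^ 3) ^ 2 -
        4 * (MvPolynomial.X 0 ^ 3 * MvPolynomial.X 1 ^ 3 + MvPolynomial.X 0 ^ 8 + MvPolynomial.X 1 ^ 8)) := by
  intro hd
  -- `d` is integral over the integrally closed `k[x,y]`, hence comes from it
  have hint : IsIntegral (MvPolynomial (Fin 2) k) d := by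
    refine ⟨Polynomial.X ^ 2 - Polynomial.C ((MvPolynomial.X 0 ^ 3 + MvPolynomial.X 1 ^ 3) ^ 2 -
        4 * (MvPolynomial.X 0 ^ 3 * MvPolynomial.X 1 ^ 3 + MvPolynomial.X 0 ^ 8 + MvPolynomial.X 1 ^ 8)),
      monic_X_pow_sub_C _ two_ne_zero, ?_⟩
    rw [eval₂_sub, eval₂_X_pow, eval₂_C, hd, sub_self]
  obtain ⟨e, he⟩ := (IsIntegrallyClosed.isIntegral_iff (R := MvPolynomial (Fin 2) k)).mp hint
  rw [← he, ← map_pow] at hd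
  have hd' := IsFractionRing.injective (MvPolynomial (Fin 2) k) (FractionRing (MvPolynomial (Fin 2) k)) hd
  have h := congrArg (MvPolynomial.aeval (R := k) (![Polynomial.X, 0] : Fin 2 → k[X])) hd'
  simp only [map_pow, map_sub, map_mul, map_add, specialise_X0, specialise_X1, map_ofNat] at h
  refine not_sq_specialised _ (h.trans ?_)
  ring

/-- **`x³y³+x⁸+y⁸` is not a cube in `k(x,y)`.** [folklore] -/
theorem not_cube (r : FractionRing (MvPolynomial (Fin 2) k)) :
    r ^ 3 ≠ algebraMap (MvPolynomial (Fin 2) k) (FractionRing (MvPolynomial (Fin 2) k))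
      (MvPolynomial.X 0 ^ 3 * MvPolynomial.X 1 ^ 3 + MvPolynomial.X 0 ^ 8 + MvPolynomial.X 1 ^ 8) := by
  intro hr
  have hint : IsIntegral (MvPolynomial (Fin 2) k) r := by
    refine ⟨Polynomial.X ^ 3 - Polynomial.C (MvPolynomial.X 0 ^ 3 * MvPolynomial.X 1 ^ 3 + MvPolynomial.X 0 ^ 8 +
        MvPolynomial.X 1 ^ 8), monic_X_pow_sub_C _ three_ne_zero, ?_⟩
    rw [eval₂_sub, eval₂_X_pow, eval₂_C, hr, sub_self]
  obtain ⟨e, he⟩ := (IsIntegrallyClosed.isIntegral_iff (R := MvPolynomial (Fin 2) k)).mp hint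
  rw [← he, ← map_pow] at hr
  have hr' := IsFractionRing.injective (MvPolynomial (Fin 2) k) (FractionRing (MvPolynomial (Fin 2) k)) hr
  have h := congrArg (MvPolynomial.aeval (R := k) (![Polynomial.X, 0] : Fin 2 → k[X])) hr'
  simp only [map_pow, map_mul, map_add, specialise_X0, specialise_X1] at h
  refine not_cube_specialised _ (h.trans ?_)
  ring

/-- **`z⁶ + (x³+y³)z³ + (x³y³+x⁸+y⁸)` is irreducible in `k[x,y][z]`** (`char k = 5`): Capelli–Kummer over `k(x,y)` + Gauss.
[folklore] -/
theorem irreducible_sextic_R [CharP k 5] :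
    Irreducible (Polynomial.X ^ 6 + Polynomial.C (MvPolynomial.X 0 ^ 3 + MvPolynomial.X 1 ^ 3 : MvPolynomial (Fin 2) k) *
      Polynomial.X ^ 3 + Polynomial.C (MvPolynomial.X 0 ^ 3 * MvPolynomial.X 1 ^ 3 + MvPolynomial.X 0 ^ 8 + MvPolynomial.X 1 ^ 8)) := by
  haveI : IsIntegrallyClosed (MvPolynomial (Fin 2) k) := UniqueFactorizationMonoid.instIsIntegrallyClosed
  have h2R : (2 : MvPolynomial (Fin 2) k) ≠ 0 := by
    intro h0
    have := (CharP.cast_eq_zero_iff (MvPolynomial (Fin 2) k) 5 2).mp (by exact_mod_cast h0)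
    omega
  have h2 : (2 : FractionRing (MvPolynomial (Fin 2) k)) ≠ 0 := by
    intro h0
    apply h2R
    apply IsFractionRing.injective (MvPolynomial (Fin 2) k) (FractionRing (MvPolynomial (Fin 2) k))
    rw [map_ofNat, map_zero]
    exact h0
  have hF := Q6PrimeTower.irreducible_sextic h2
    (algebraMap (MvPolynomial (Fin 2) k) (FractionRing (MvPolynomial (Fin 2) k)) (MvPolynomial.X 0 ^ 3 + MvPolynomial.X 1 ^ 3))
    (algebraMap (MvPolynomial (Fin 2) k) (FractionRing (MvPolynomial (Fin 2) k))
      (MvPolynomial.X 0 ^ 3 * MvPolynomial.X 1 ^ 3 + MvPolynomial.X 0 ^ 8 + MvPolynomial.X 1 ^ 8))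
    (fun d hd => not_sq d (by rw [hd, map_sub, map_pow, map_mul, map_ofNat])) (fun r hr => not_cube r hr)
  rw [(sextic_monic' _ _).irreducible_iff_irreducible_map_fraction_map (K := FractionRing (MvPolynomial (Fin 2) k))]
  have hmap : (Polynomial.X ^ 6 + Polynomial.C (MvPolynomial.X 0 ^ 3 + MvPolynomial.X 1 ^ 3 : MvPolynomial (Fin 2) k) *
      Polynomial.X ^ 3 + Polynomial.C (MvPolynomial.X 0 ^ 3 * MvPolynomial.X 1 ^ 3 + MvPolynomial.X 0 ^ 8 + MvPolynomial.X 1 ^ 8)).map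
      (algebraMap (MvPolynomial (Fin 2) k) (FractionRing (MvPolynomial (Fin 2) k))) =
      Polynomial.X ^ 6 + Polynomial.C (algebraMap (MvPolynomial (Fin 2) k) (FractionRing (MvPolynomial (Fin 2) k))
        (MvPolynomial.X 0 ^ 3 + MvPolynomial.X 1 ^ 3)) * Polynomial.X ^ 3 +
      Polynomial.C (algebraMap (MvPolynomial (Fin 2) k) (FractionRing (MvPolynomial (Fin 2) k))
        (MvPolynomial.X 0 ^ 3 * MvPolynomial.X 1 ^ 3 + MvPolynomial.X 0 ^ 8 + MvPolynomial.X 1 ^ 8)) := by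
    rw [Polynomial.map_add, Polynomial.map_add, Polynomial.map_mul, Polynomial.map_pow, Polynomial.map_pow, Polynomial.map_X,
      Polynomial.map_C, Polynomial.map_C]
  rw [hmap]
  exact hF

/-! ## In `k[x,y,z]` -/

/-- The coordinate change `k[x,y,z] ≅ k[x,y][z]` (`z ↦ X`, `x ↦ C y'`, `y ↦ C x'`) carries `f₂` to the sextic. -/
theorem transfer_f2 (f : MvPolynomial (Fin 3) k)
    (hf : f = MvPolynomial.X 0 ^ 3 * MvPolynomial.X 1 ^ 3 + MvPolynomial.X 0 ^ 3 * MvPolynomial.X 2 ^ 3 +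
        MvPolynomial.X 1 ^ 3 * MvPolynomial.X 2 ^ 3 + MvPolynomial.X 2 ^ 6 + MvPolynomial.X 0 ^ 8 + MvPolynomial.X 1 ^ 8) :
    ((MvPolynomial.renameEquiv k (Equiv.swap (0 : Fin 3) 2)).trans (MvPolynomial.finSuccEquiv k 2)) f =
      Polynomial.X ^ 6 + Polynomial.C (MvPolynomial.X 0 ^ 3 + MvPolynomial.X 1 ^ 3 : MvPolynomial (Fin 2) k) *
        Polynomial.X ^ 3 + Polynomial.C (MvPolynomial.X 0 ^ 3 * MvPolynomial.X 1 ^ 3 + MvPolynomial.X 0 ^ 8 + MvPolynomial.X 1 ^ 8) := by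
  have h0 : ((MvPolynomial.renameEquiv k (Equiv.swap (0 : Fin 3) 2)).trans (MvPolynomial.finSuccEquiv k 2))
      (MvPolynomial.X 0) = Polynomial.C (MvPolynomial.X 1) := by
    rw [AlgEquiv.trans_apply, MvPolynomial.renameEquiv_apply, MvPolynomial.rename_X, Equiv.swap_apply_left,
      show (2 : Fin 3) = Fin.succ 1 from rfl, MvPolynomial.finSuccEquiv_X_succ]
  have h1 : ((MvPolynomial.renameEquiv k (Equiv.swap (0 : Fin 3) 2)).trans (MvPolynomial.finSuccEquiv k 2))
      (MvPolynomial.X 1) = Polynomial.C (MvPolynomial.X 0) := by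
    rw [AlgEquiv.trans_apply, MvPolynomial.renameEquiv_apply, MvPolynomial.rename_X,
      Equiv.swap_apply_of_ne_of_ne (by decide) (by decide), show (1 : Fin 3) = Fin.succ 0 from rfl,
      MvPolynomial.finSuccEquiv_X_succ]
  have h2 : ((MvPolynomial.renameEquiv k (Equiv.swap (0 : Fin 3) 2)).trans (MvPolynomial.finSuccEquiv k 2))
      (MvPolynomial.X 2) = Polynomial.X := by
    rw [AlgEquiv.trans_apply, MvPolynomial.renameEquiv_apply, MvPolynomial.rename_X, Equiv.swap_apply_right,
      MvPolynomial.finSuccEquiv_X_zero]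
  rw [hf]
  simp only [map_add, map_mul, map_pow, h0, h1, h2]
  simp only [← map_pow, ← map_mul, ← map_add]
  ring_nf
  simp only [map_add, map_mul, map_pow]
  ring

/-- **`f₂` is irreducible in `k[x,y,z]`** (`char k = 5`). [folklore] -/
theorem q6_irreducible [CharP k 5] (f : MvPolynomial (Fin 3) k)
    (hf : f = MvPolynomial.X 0 ^ 3 * MvPolynomial.X 1 ^ 3 + MvPolynomial.X 0 ^ 3 * MvPolynomial.X 2 ^ 3 +
        MvPolynomial.X 1 ^ 3 * MvPolynomial.X 2 ^ 3 + MvPolynomial.X 2 ^ 6 + MvPolynomial.X 0 ^ 8 + MvPolynomial.X 1 ^ 8) :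
    Irreducible f := by
  have h := transfer_f2 f hf
  have hirr := irreducible_sextic_R (k := k)
  rw [← h] at hirr
  exact (MulEquiv.irreducible_iff
    ((MvPolynomial.renameEquiv k (Equiv.swap (0 : Fin 3) 2)).trans (MvPolynomial.finSuccEquiv k 2)).toMulEquiv).mp hirr

/-- **`f₂ ≠ 0`.** [folklore] -/
theorem q6_ne_zero [CharP k 5] (f : MvPolynomial (Fin 3) k)
    (hf : f = MvPolynomial.X 0 ^ 3 * MvPolynomial.X 1 ^ 3 + MvPolynomial.X 0 ^ 3 * MvPolynomial.X 2 ^ 3 +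
        MvPolynomial.X 1 ^ 3 * MvPolynomial.X 2 ^ 3 + MvPolynomial.X 2 ^ 6 + MvPolynomial.X 0 ^ 8 + MvPolynomial.X 1 ^ 8) :
    f ≠ 0 :=
  (q6_irreducible f hf).ne_zero

/-- **`(f₂)` IS A PRIME IDEAL of `k[x,y,z]` for every field `k` of characteristic `5`.** [folklore] -/
theorem q6_isPrime [CharP k 5] (f : MvPolynomial (Fin 3) k)
    (hf : f = MvPolynomial.X 0 ^ 3 * MvPolynomial.X 1 ^ 3 + MvPolynomial.X 0 ^ 3 * MvPolynomial.X 2 ^ 3 +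
        MvPolynomial.X 1 ^ 3 * MvPolynomial.X 2 ^ 3 + MvPolynomial.X 2 ^ 6 + MvPolynomial.X 0 ^ 8 + MvPolynomial.X 1 ^ 8) :
    (Ideal.span {f}).IsPrime :=
  (Ideal.span_singleton_prime (q6_ne_zero f hf)).mpr (q6_irreducible f hf).prime

/-- **`x̄ⱼ ≠ 0` in `k[x,y,z]/(f₂)`** (the sextic in `z` cannot divide a variable). [folklore] -/
theorem q6_X_ne_zero [CharP k 5] (f : MvPolynomial (Fin 3) k)
    (hf : f = MvPolynomial.X 0 ^ 3 * MvPolynomial.X 1 ^ 3 + MvPolynomial.X 0 ^ 3 * MvPolynomial.X 2 ^ 3 +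
        MvPolynomial.X 1 ^ 3 * MvPolynomial.X 2 ^ 3 + MvPolynomial.X 2 ^ 6 + MvPolynomial.X 0 ^ 8 + MvPolynomial.X 1 ^ 8)
    (j : Fin 3) : Ideal.Quotient.mk (Ideal.span {f}) (MvPolynomial.X j) ≠ 0 := by
  -- the image of `X j` under the coordinate change has degree ≤ 1
  have hle : (((MvPolynomial.renameEquiv k (Equiv.swap (0 : Fin 3) 2)).trans (MvPolynomial.finSuccEquiv k 2))
      (MvPolynomial.X j)).natDegree ≤ 1 := by
    rcases (by decide : ∀ j : Fin 3, j = 0 ∨ j = 1 ∨ j = 2) j with rfl | rfl | rfl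
    · rw [AlgEquiv.trans_apply, MvPolynomial.renameEquiv_apply, MvPolynomial.rename_X, Equiv.swap_apply_left,
          show (2 : Fin 3) = Fin.succ 1 from rfl, MvPolynomial.finSuccEquiv_X_succ, natDegree_C]
      exact zero_le_one
    · rw [AlgEquiv.trans_apply, MvPolynomial.renameEquiv_apply, MvPolynomial.rename_X,
          Equiv.swap_apply_of_ne_of_ne (by decide) (by decide), show (1 : Fin 3) = Fin.succ 0 from rfl,
          MvPolynomial.finSuccEquiv_X_succ, natDegree_C]
      exact zero_le_one
    · rw [AlgEquiv.trans_apply, MvPolynomial.renameEquiv_apply, MvPolynomial.rename_X, Equiv.swap_apply_right,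
          MvPolynomial.finSuccEquiv_X_zero, natDegree_X]
  intro h0
  rw [Ideal.Quotient.eq_zero_iff_mem, Ideal.mem_span_singleton] at h0
  obtain ⟨q, hq⟩ := h0
  have h := congrArg ((MvPolynomial.renameEquiv k (Equiv.swap (0 : Fin 3) 2)).trans (MvPolynomial.finSuccEquiv k 2)) hq
  rw [map_mul, transfer_f2 f hf] at h
  -- degrees: the image of `X j` has degree ≤ 1, the sextic is monic of degree 6
  have hq0 : ((MvPolynomial.renameEquiv k (Equiv.swap (0 : Fin 3) 2)).trans (MvPolynomial.finSuccEquiv k 2)) q ≠ 0 := by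
    intro hz
    rw [hz, mul_zero, EmbeddingLike.map_eq_zero_iff] at h
    exact MvPolynomial.X_ne_zero j h
  have hdeg := congrArg Polynomial.natDegree h
  rw [(sextic_monic' _ _).natDegree_mul' hq0, sextic_natDegree'] at hdeg
  omega

end Summit.ResolutionOfSingularities.ResolutionOfSingularities.Theorems.FInjectiveMacaulayfication.Q6Prime

end
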